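import Summits.HodgeConjecture.HodgeConjecture.Theorems.F0P3cStCharTSEllOut   -- ★ (LH6-p03 g4) p851130 «ELL-OUT★»: `char_eq_zero_on_ellG_of_not_isEllipticRep`; brings ★ TR carpet `Ch12Sec5Inputs` ((L2D∀) `L2CharOnTorusAll`, (C2) `EllCartanAE`), ★ `Ch12Sec5Defs`
import HarnessLib

/-!
# F0 · P3c · line LH6 «StCharTS» — brick «L2D-ELL★» for the (S-𝔇) package `stub_EllipticPackage`:
# THE SOCKET (L2D∀) `L2CharOnTorusAll` NARROWS TO THE ELLIPTIC CLASSES (its non-elliptic instances are trivial in-package)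

Cell `hodgecm-mathlib`, crux `H413` (`stmt-HodgeConjecture-24833`), line LH6 `Cruxes/H413/Lines/F0_P3c_StCharTSPaydown.lean` (organ (S-𝔇) `stub_EllipticPackage`).  Seat LH6-p02
(g4); THEOREMS ONLY (no `def`, no named fact, no `instance`, no notation, no `sorry`; axioms ⊆ {propext, Classical.choice, Quot.sound}); `--supports stmt-HodgeConjecture-24833
--as helper`.  Sequel to ★ «SOCKETS-OUT★» p850909 ∕ «MATE-UNIQ-OUT★» p851141 (this seat), ★ «LDSU-OUT★» p851084 (LH6-p04), ★ «ELL-OUT★» p851130 (LH6-p03).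
HONEST LABEL: HC_CM is proved only modulo the 7 printed citations (2 remaining: hLiu418 = stmt-HodgeConjecture-24832, h413 = stmt-HodgeConjecture-24833) until rung 0
closes; this file is count-neutral — it lets a later leaf edition RE-LETTER the socket (L2D∀) ★ `EllipticData.L2CharOnTorusAll` («`D_G·χ_π ∈ L²(T, dγ)` on every elliptic Cartan
representative, for EVERY class `π`» — typed wider than print's scope so that the consumers may pair arbitrary members of `supp aX`) to its ELLIPTIC instances (L2D-ell)
«… for every ELLIPTIC `π`», which is the scope of the printed input ([Rogawski1990, §12.5 p. 184; §12.6 pp. 187–188]: `D_G χ_π` on the elliptic set for the elliptic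
(in particular the square-integrable) classes; [C₄] = Clozel's Howe-finiteness, cited by print for square-integrable `π`).

THE MATHEMATICS (elementary).  If `π` is NOT elliptic, its character vanishes identically on `G^e` (definition of «elliptic representation», p. 187; ★ «ELL-OUT★»
`char_eq_zero_on_ellG_of_not_isEllipticRep`); by (C2) ★ `EllCartanAE` `dγ`-almost every point of an elliptic Cartan representative `T ∈ cartanG` lies in `G^e`, so
`t ↦ D_G(t)·χ_π(t)` is `dγ`-a.e. ZERO on `T`, hence in `L²(T, dγ)` (Mathlib `MemLp.ae_eq` from the zero function).  Therefore
**(L2D∀) ⟸ (L2D-ell) ∧ (C2)**: `l2CharOnTorusAll_of_elliptic`.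

LEAF EFFECT (for the ED. pen, a later edition): replace the conjunct `𝔇.L2CharOnTorusAll ∧` by
`(∀ π : IrrClass (Gqs L v), 𝔇.IsEllipticRep π → ∀ T ∈ 𝔇.cartanG, MemLp (fun t : ↥T => (𝔇.DG (t : Gqs L v) : ℂ) * 𝔇.char π (t : Gqs L v)) 2 (𝔇.μT T)) ∧`
(obtain name `hL2ell`), and feed `hL2all := (F0P3cStCharTSL2dEll.l2CharOnTorusAll_of_elliptic 𝔇 hTell hL2ell)` where `hL2all` was used.

## References
* [Rogawski1990] J. D. Rogawski, *Automorphic Representations of Unitary Groups in Three Variables*, Ann. of Math. Stud. 123 (1990): §12.5 p. 184 (`⟨ , ⟩_{G,e}`, `G^e`,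
  the elliptic Cartan representatives); §12.6 p. 187 («elliptic representation»), pp. 187–188 (orthogonality relations for elliptic classes).
-/

set_option autoImplicit false
-- the mandated namespace has the single-problem summit's repeated segment (`HodgeConjecture.HodgeConjecture`)
set_option linter.dupNamespace false

noncomputable section

open MeasureTheory Filter
open Literature.NumberTheory.Automorphic Literature.NumberTheory.Rogawski1990

namespace Summit.HodgeConjecture.HodgeConjecture.Cruxes.H413.F0P3cStCharTSL2dEll

variable {G H : Type} [Group G] [TopologicalSpace G] [IsTopologicalGroup G] [MeasurableSpace G]
  [∀ γ : G, MeasurableSpace (G ⧸ Subgroup.centralizer ({γ} : Set G))] [MeasurableSpace (G ⧸ Subgroup.center G)]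
  [Group H] [TopologicalSpace H] [IsTopologicalGroup H] [MeasurableSpace H]
  (𝔇 : Ch12Sec5.EllipticData G H)

/-- **`D_G·α` is `dγ`-a.e. zero on every elliptic Cartan representative when `α ≡ 0` on `G^e`** ((C2) ★ `EllCartanAE`). [cite: Rogawski1990, §12.5 p. 184] -/
theorem dg_mul_ae_eq_zero_of_forall_mem_ellG (hC2 : 𝔇.EllCartanAE) {α : G → ℂ} (hα : ∀ γ ∈ 𝔇.ellG, α γ = 0)
    {T : Subgroup G} (hT : T ∈ 𝔇.cartanG) :
    (fun t : ↥T => (𝔇.DG (t : G) : ℂ) * α (t : G)) =ᵐ[𝔇.μT T] 0 := by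
  filter_upwards [hC2 T hT] with t ht
  rw [Pi.zero_apply, hα _ ht, mul_zero]

/-- **A function vanishing on `G^e` has `D_G·α ∈ L²(T, dγ)` on every elliptic Cartan representative** (a.e. zero by (C2)). [cite: Rogawski1990, §12.5 p. 184] -/
theorem memLp_dg_mul_of_forall_mem_ellG (hC2 : 𝔇.EllCartanAE) {α : G → ℂ} (hα : ∀ γ ∈ 𝔇.ellG, α γ = 0) :
    ∀ T ∈ 𝔇.cartanG, MemLp (fun t : ↥T => (𝔇.DG (t : G) : ℂ) * α (t : G)) 2 (𝔇.μT T) :=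
  fun _ hT => (MemLp.zero' (ε := ℂ)).ae_eq (dg_mul_ae_eq_zero_of_forall_mem_ellG 𝔇 hC2 hα hT).symm

/-- **The (L2D∀) instance of a NON-elliptic class is trivial**: if `χ_π ≡ 0` on `G^e` (★ «ELL-OUT★» `char_eq_zero_on_ellG_of_not_isEllipticRep`), then `D_G·χ_π` is a.e. zero,
hence square-integrable, on every `T ∈ cartanG`. [cite: Rogawski1990, §12.6 p. 187; §12.5 p. 184] -/
theorem memLp_char_of_not_isEllipticRep (hC2 : 𝔇.EllCartanAE) {π : IrrClass G} (hne : ¬ 𝔇.IsEllipticRep π) :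
    ∀ T ∈ 𝔇.cartanG, MemLp (fun t : ↥T => (𝔇.DG (t : G) : ℂ) * 𝔇.char π (t : G)) 2 (𝔇.μT T) :=
  memLp_dg_mul_of_forall_mem_ellG 𝔇 hC2 (F0P3cStCharTSEllOut.char_eq_zero_on_ellG_of_not_isEllipticRep 𝔇 π hne)

/-- **(L2D∀) ⟸ (L2D-ell) ∧ (C2)**: ★ `EllipticData.L2CharOnTorusAll` («`D_G·χ_π ∈ L²(T, dγ)` on every elliptic Cartan representative, for EVERY class») follows from its
instances at the ELLIPTIC classes — the scope of print's input [§12.5 p. 184; §12.6 pp. 187–188] — and (C2).  At the leaf: `hL2all := l2CharOnTorusAll_of_elliptic 𝔇 hTell hL2ell`.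
[cite: Rogawski1990, §12.5 p. 184; §12.6 pp. 187–188] -/
theorem l2CharOnTorusAll_of_elliptic (hC2 : 𝔇.EllCartanAE)
    (hL2ell : ∀ π : IrrClass G, 𝔇.IsEllipticRep π → ∀ T ∈ 𝔇.cartanG, MemLp (fun t : ↥T => (𝔇.DG (t : G) : ℂ) * 𝔇.char π (t : G)) 2 (𝔇.μT T)) :
    𝔇.L2CharOnTorusAll := by
  intro π
  by_cases hπ : 𝔇.IsEllipticRep π
  · exact hL2ell π hπ
  · exact memLp_char_of_not_isEllipticRep 𝔇 hC2 hπ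

end Summit.HodgeConjecture.HodgeConjecture.Cruxes.H413.F0P3cStCharTSL2dEll

end
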